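/-
Copyright (c) 2026 the pub-hodgecm-mathlib formalisation cell (harness21).  Prover seat hodgecm-mathlib-K2E5-p16 (g5): Track B «K2-LIT»,
hLiu418 = stmt-HodgeConjecture-24832, ROAD Φ organ Φ6b-6 (β-shift of Shimura's `η` on `Herm₂(ℂ)`), file (2): absolute convergence of the
β-shifted `η` on `ℂ × {re β > 0}`; 2026-09-04.
-/
import Summits.HodgeConjecture.HodgeConjecture.Theorems.K2LiuHermTwoEtaShiftDefs             -- 📤 p858372: `etaShiftWeight`, `etaShift`, …
import Summits.HodgeConjecture.HodgeConjecture.Theorems.K2LiuHermTwoEtaConvergence           -- ★ p857940: `η` converges, KEY DOMINATION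
import Summits.HodgeConjecture.HodgeConjecture.Theorems.K2LiuHermTwoEtaHolomorphy            -- ★ p858099: `det_two_le_det_add`, norms
import Summits.HodgeConjecture.HodgeConjecture.Theorems.K2LiuHermTwoEtaGrowth                -- ★ p858124: `measurePreserving_add_const`
import Summits.HodgeConjecture.HodgeConjecture.Theorems.K2LiuHermTwoConeInvEntryIntegrable   -- ★ p858362: (M1) weighted cone integral
import HarnessLib

/-!
# Crux `HLiu418`, ROAD Φ, organ Φ6b-6 — file (2): the β-shifted `η` converges absolutely for `re β > 0`

Cell `hodgecm-mathlib`, crux item hLiu418 = `stmt-HodgeConjecture-24832`, route of record `HCCMUnconditional`; squad K2, LEAD F0P6-plan (g12)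
(«= GO the first-order vehicle» 2026-09-04 07:40:27Z), co-dealer K2E5-plan (g6), prover K2E5-p16 (g5).  THEOREMS ONLY (no `def`, no instance,
no notation, no named-fact hypothesis, no `sorry`, default heartbeats); lane `--supports stmt-HodgeConjecture-24832 --as helper`.

WHAT IS PROVED.  For `g, h > 0` (positive definite `2 × 2` Hermitian), in the chart `x = hermTwo (a, z, b)`, domain `{x − h > 0}`:
* `integrableOn_inv_mul_etaTwoIntegrand_of_posDef (hg) (hh) (α) (hβ : 1 < β.re)` — the WEIGHTED `η`-integrand
  `x ↦ (x − h)₁₁⁻¹ · e^{−tr(gx)} det(x + h)^{α−2} det(x − h)^{β−2}` is integrable for every `α` and `re β > 1` (the weight `1∕(x − h)₁₁` is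
  singular on a ray of the boundary; after `x = u + h` this is the KEY DOMINATION `det(u + 2h)^{re α−2} ≤ K e^{τ(ug)∕2}` of ★ `K2LiuHermTwoEtaConvergence`
  against ★ (M1) `integrableOn_inv_snd_mul_siegelGindikin` at `(g∕2, re β)`);
* `norm_etaShiftWeight_le (hh) (hc : x − h > 0)` — `‖Q_α(x)‖ ≤ (‖g₀₀‖ + 2h₁₁‖α−2‖∕det(2h))·(x − h)₁₁⁻¹ + ‖α−2‖∕det(2h)`
  (`det(x + h) ≥ det(2h)` on the domain, ★ `det_two_le_det_add`);
* `integrableOn_etaShiftIntegrand (hg) (hh) (α) (hβ : 0 < β.re)` — THE β-SHIFTED INTEGRAND `Q_α · η-integrand(α, β+1)` IS INTEGRABLE on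
  `{x − h > 0}` for every `α` and `re β > 0` (one unit LEFT of the abscissa `re β > 1` of `η` itself);
* `etaShift_eq_integral_of_posDef` — `etaShift g h α β = ∫_{x − h > 0} etaShiftIntegrand`.
HONEST LABEL.  Count-neutral helper of the K2_Liu road; it pays no socket by itself: `HC_CM` is proved only modulo the 7 printed citations
(2 remaining named inputs: hLiu418 = `stmt-HodgeConjecture-24832`, h413 = `stmt-HodgeConjecture-24833`) until rung 0 closes.
-/

set_option autoImplicit false
-- the mandated namespace repeats the single-problem summit's segment (`HodgeConjecture.HodgeConjecture`)
set_option linter.dupNamespace false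

noncomputable section

open Complex MeasureTheory Set
open scoped ComplexOrder ComplexConjugate

namespace Summit.HodgeConjecture.HodgeConjecture.Cruxes.HLiu418.K2LiuHermTwoEtaShiftConvergence

open Summit.HodgeConjecture.HodgeConjecture.Cruxes.HLiu418.K2LiuHermTwoGammaDefs
open Summit.HodgeConjecture.HodgeConjecture.Cruxes.HLiu418.K2LiuHermTwoGammaSiegelGindikin
open Summit.HodgeConjecture.HodgeConjecture.Cruxes.HLiu418.K2LiuHermTwoEtaDefs
open Summit.HodgeConjecture.HodgeConjecture.Cruxes.HLiu418.K2LiuHermTwoEtaConvergence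
open Summit.HodgeConjecture.HodgeConjecture.Cruxes.HLiu418.K2LiuHermTwoEtaHolomorphy
open Summit.HodgeConjecture.HodgeConjecture.Cruxes.HLiu418.K2LiuHermTwoEtaGrowth
open Summit.HodgeConjecture.HodgeConjecture.Cruxes.HLiu418.K2LiuHermTwoConeInvEntryIntegrable
open Summit.HodgeConjecture.HodgeConjecture.Cruxes.HLiu418.K2LiuHermTwoEtaShiftDefs

/-! ## The weighted `η`-integrand converges (`re β > 1`) -/

/-- The weight's denominator after the translation `x = u + h`: `((u + h) − h)₁₁ = u₁₁ = b`. -/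
theorem hermTwo_add_sub_apply_one_one (c e : ℝ × ℂ × ℝ) : (hermTwo (c + e) - hermTwo e) 1 1 = (c.2.2 : ℂ) := by
  rw [hermTwo_add, add_sub_cancel_right, hermTwo_apply_one_one]

/-- **THE WEIGHTED `η`-INTEGRAND CONVERGES**: for `g, h > 0`, every `α` and `re β > 1`, the function
`x ↦ (x − h)₁₁⁻¹ · [η-integrand(g, h; α, β)](x)` is integrable on the domain `{x ± h > 0} = {x − h > 0}`. -/
theorem integrableOn_inv_mul_etaTwoIntegrand_of_posDef {g h : Matrix (Fin 2) (Fin 2) ℂ} (hg : g.PosDef) (hh : h.PosDef) (α : ℂ) {β : ℂ}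
    (hβ : 1 < β.re) : IntegrableOn (fun c : ℝ × ℂ × ℝ => ((hermTwo c - h) 1 1)⁻¹ * etaTwoIntegrand g h α β c) (etaTwoSet h) := by
  -- coordinates of `g` and `h`
  have hg' : hermTwo ((g 0 0).re, g 0 1, (g 1 1).re) = g := hermTwo_eq_of_isHermitian hg.1
  have hdg := (posDef_hermTwo_iff ((g 0 0).re, g 0 1, (g 1 1).re)).mp (hg'.symm ▸ hg)
  set d : ℝ × ℂ × ℝ := ((g 0 0).re, g 0 1, (g 1 1).re) with hd
  have hh' : hermTwo ((h 0 0).re, h 0 1, (h 1 1).re) = h := hermTwo_eq_of_isHermitian hh.1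
  have heh := (posDef_hermTwo_iff ((h 0 0).re, h 0 1, (h 1 1).re)).mp (hh'.symm ▸ hh)
  set e : ℝ × ℂ × ℝ := ((h 0 0).re, h 0 1, (h 1 1).re) with he
  have hp : 0 < d.1 := hdg.1
  have hw : normSq d.2.1 < d.1 * d.2.2 := hdg.2
  -- `2h` in the chart
  have h2e : 0 < (e + e).1 ∧ normSq (e + e).2.1 < (e + e).1 * (e + e).2.2 := by
    obtain ⟨h1, h2⟩ := heh
    refine ⟨by simp only [Prod.fst_add]; linarith, ?_⟩
    simp only [Prod.fst_add, Prod.snd_add]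
    rw [show e.2.1 + e.2.1 = (2 : ℂ) * e.2.1 by ring, map_mul, show normSq (2 : ℂ) = 4 by norm_num [normSq_apply]]
    nlinarith
  -- the domain is `{x − h > 0}`; translate by `h`
  rw [etaTwoSet_eq_of_posSemidef hh.posSemidef, ← hh']
  have hT := measurePreserving_add_const e
  have hTe : MeasurableEmbedding (fun c : ℝ × ℂ × ℝ => c + e) := (MeasurableEquiv.addRight e).measurableEmbedding
  have hpre : (fun c : ℝ × ℂ × ℝ => c + e) ⁻¹' {c | (hermTwo c - hermTwo e).PosDef} = {c | (hermTwo c).PosDef} := by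
    ext c
    simp only [Set.mem_preimage, Set.mem_setOf_eq, hermTwo_add, add_sub_cancel_right]
  rw [← hT.integrableOn_comp_preimage hTe, hpre]
  -- the key domination constant for `r = re α − 2`
  obtain ⟨K, hK, hKle⟩ := det_add_rpow_le (w := d.2.1) (w' := (e + e).2.1) (q := d.2.2) (q' := (e + e).2.2) hp hw h2e.1 h2e.2 (α.re - 2)
  -- the weighted Siegel–Gindikin majorant at `g/2` (★ M1)
  have hhalf : 0 < ((1 / 2 : ℝ) • d).1 ∧ normSq ((1 / 2 : ℝ) • d).2.1 < ((1 / 2 : ℝ) • d).1 * ((1 / 2 : ℝ) • d).2.2 := by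
    simp only [Prod.smul_fst, Prod.smul_snd, smul_eq_mul, Complex.real_smul]
    refine ⟨by positivity, ?_⟩
    rw [map_mul, show normSq ((1 / 2 : ℝ) : ℂ) = 1 / 4 by rw [normSq_ofReal]; norm_num]
    nlinarith
  have hM1 := (integrableOn_inv_snd_mul_siegelGindikin ((1 / 2 : ℝ) • d) hhalf hβ).const_mul
    (K * Real.exp (-(e.1 * d.1 + e.2.2 * d.2.2 + 2 * (e.2.1 * conj d.2.1).re)))
  have hwm : Measurable fun c : ℝ × ℂ × ℝ => ((hermTwo c - hermTwo e) 1 1)⁻¹ := by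
    have hf : (fun c : ℝ × ℂ × ℝ => ((hermTwo c - hermTwo e) 1 1)⁻¹) = fun c => (((c.2.2 - e.2.2 : ℝ) : ℂ))⁻¹ := by
      funext c
      rw [hermTwo_sub_apply_one_one, hermTwo_apply_one_one, ← Complex.ofReal_sub]
    rw [hf]
    exact (Complex.measurable_ofReal.comp ((measurable_snd.comp measurable_snd).sub_const _)).inv
  refine hM1.mono' ?_ ?_
  · exact ((hwm.mul (measurable_etaTwoIntegrand g (hermTwo e) α β)).comp (measurable_id.add_const e)).aestronglyMeasurable
  · refine (ae_restrict_iff' measurableSet_posDef_hermTwo).mpr (Filter.Eventually.of_forall fun c hc => ?_)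
    have hc' := (posDef_hermTwo_iff c).mp hc
    obtain ⟨a, z, b⟩ := c
    obtain ⟨ha, hz⟩ := hc'
    have hb : 0 < b := snd_pos_of_cone ha hz
    -- names for the real quantities
    set T : ℝ := a * d.1 + b * d.2.2 + 2 * (z * conj d.2.1).re with hTdef
    set Te : ℝ := e.1 * d.1 + e.2.2 * d.2.2 + 2 * (e.2.1 * conj d.2.1).re with hTedef
    have hdetx : 0 < a * b - normSq z := by linarith
    have h2e' : 0 < e.1 + e.1 ∧ normSq (e.2.1 + e.2.1) < (e.1 + e.1) * (e.2.2 + e.2.2) := by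
      simpa only [Prod.fst_add, Prod.snd_add] using h2e
    have hdet2 : 0 < (a + (e.1 + e.1)) * (b + (e.2.2 + e.2.2)) - normSq (z + (e.2.1 + e.2.1)) := by
      have := det_add_ge (w := e.2.1 + e.2.1) (q := e.2.2 + e.2.2) ha hz h2e'.1 h2e'.2
      linarith [h2e'.2]
    -- the norms
    have hL0 : ‖((hermTwo ((a, z, b) + e) - hermTwo e) 1 1)⁻¹‖ = b⁻¹ := by
      rw [hermTwo_add_sub_apply_one_one, norm_inv, Complex.norm_of_nonneg hb.le]
    have hL1 : ‖cexp (-(hermTwo ((a, z, b) + e) * hermTwo d).trace)‖ = Real.exp (-(T + Te)) := by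
      rw [Complex.norm_exp, trace_hermTwo_mul_hermTwo]
      congr 1
      simp only [Prod.fst_add, Prod.snd_add, neg_re, ofReal_re, hTdef, hTedef, add_mul, Complex.add_re, mul_add]
      ring
    have hL2 : ‖(hermTwo ((a, z, b) + e + e)).det ^ (α - 2)‖ =
        ((a + (e.1 + e.1)) * (b + (e.2.2 + e.2.2)) - normSq (z + (e.2.1 + e.2.1))) ^ (α.re - 2) := by
      have hx : (a, z, b) + e + e = (a + (e.1 + e.1), z + (e.2.1 + e.2.1), b + (e.2.2 + e.2.2)) := by
        ext <;> simp [add_assoc]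
      rw [hx, det_hermTwo, norm_cpow_eq_rpow_re_of_pos hdet2]
      simp
    have hL3 : ‖(hermTwo (a, z, b)).det ^ (β - 2)‖ = (a * b - normSq z) ^ (β.re - 2) := by
      rw [det_hermTwo, norm_cpow_eq_rpow_re_of_pos hdetx]
      simp
    have hR : Real.exp (-(a * ((1 / 2 : ℝ) • d).1 + b * ((1 / 2 : ℝ) • d).2.2 + 2 * (z * conj ((1 / 2 : ℝ) • d).2.1).re)) =
        Real.exp (-(T / 2)) := by
      congr 1
      simp only [Prod.smul_fst, Prod.smul_snd, smul_eq_mul, Complex.real_smul, hTdef, map_mul, Complex.conj_ofReal, Complex.mul_re,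
        Complex.mul_im, Complex.ofReal_re, Complex.ofReal_im, zero_mul, sub_zero]
      ring
    simp only [Function.comp_apply]
    rw [norm_mul, etaTwoIntegrand_add, ← hg', norm_mul, norm_mul, hL0, hL1, hL2, hL3, hR]
    -- the domination `det(x+2h)^{re α − 2} · e^{−T/2} ≤ K`
    have hKc := hKle a b z ha hz
    simp only [Prod.fst_add, Prod.snd_add] at hKc
    have hX0 : 0 ≤ Real.exp (-(T / 2)) := (Real.exp_pos _).le
    have hprod : Real.exp (-(T / 2)) * ((a + (e.1 + e.1)) * (b + (e.2.2 + e.2.2)) - normSq (z + (e.2.1 + e.2.1))) ^ (α.re - 2) ≤ K := by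
      have h1 := mul_le_mul_of_nonneg_left hKc hX0
      rw [← mul_assoc, mul_comm (Real.exp _) K, mul_assoc, ← Real.exp_add, show -(T / 2) + T / 2 = 0 by ring,
        Real.exp_zero, mul_one] at h1
      exact h1
    have hP0 : 0 ≤ Real.exp (-Te) * (b⁻¹ * (Real.exp (-(T / 2)) * (a * b - normSq z) ^ (β.re - 2))) := by positivity
    calc b⁻¹ * (Real.exp (-(T + Te)) *
          (((a + (e.1 + e.1)) * (b + (e.2.2 + e.2.2)) - normSq (z + (e.2.1 + e.2.1))) ^ (α.re - 2) * (a * b - normSq z) ^ (β.re - 2)))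
        = (Real.exp (-Te) * (b⁻¹ * (Real.exp (-(T / 2)) * (a * b - normSq z) ^ (β.re - 2)))) *
            (Real.exp (-(T / 2)) * ((a + (e.1 + e.1)) * (b + (e.2.2 + e.2.2)) - normSq (z + (e.2.1 + e.2.1))) ^ (α.re - 2)) := by
          rw [show -(T + Te) = -Te + -(T / 2) + -(T / 2) by ring, Real.exp_add, Real.exp_add]
          ring
      _ ≤ (Real.exp (-Te) * (b⁻¹ * (Real.exp (-(T / 2)) * (a * b - normSq z) ^ (β.re - 2)))) * K :=
          mul_le_mul_of_nonneg_left hprod hP0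
      _ = K * Real.exp (-Te) * (b⁻¹ * (Real.exp (-(T / 2)) * (a * b - normSq z) ^ (β.re - 2))) := by ring

/-! ## The weight is controlled by `1∕(x − h)₁₁` -/

/-- On the domain `{x − h > 0}` (`h = hermTwo e > 0`), `(x − h)₁₁ = b − e₃ > 0`. -/
theorem sub_snd_pos_of_mem {e c : ℝ × ℂ × ℝ} (hc : (hermTwo c - hermTwo e).PosDef) : 0 < c.2.2 - e.2.2 := by
  have hu := (posDef_hermTwo_iff (c - e)).mp (by rwa [hermTwo_sub])
  simpa only [Prod.snd_sub] using snd_pos_of_cone hu.1 hu.2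

/-- **THE WEIGHT BOUND**: for `h = hermTwo e > 0` and `x − h > 0`, with `δ = det(2h) > 0`,
`‖Q_α(x)‖ ≤ (‖g₀₀‖ + 2e₃‖α − 2‖∕δ) · (b − e₃)⁻¹ + ‖α − 2‖∕δ` (since `det(x + h) ≥ δ` and `(x + h)₁₁ = (b − e₃) + 2e₃`). -/
theorem norm_etaShiftWeight_le (g : Matrix (Fin 2) (Fin 2) ℂ) {e c : ℝ × ℂ × ℝ} (he : (hermTwo e).PosDef) (hc : (hermTwo c - hermTwo e).PosDef)
    (α : ℂ) :
    ‖etaShiftWeight g (hermTwo e) α c‖ ≤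
      (‖g 0 0‖ + 2 * e.2.2 * ‖α - 2‖ / ((e + e).1 * (e + e).2.2 - normSq (e + e).2.1)) * (c.2.2 - e.2.2)⁻¹ +
        ‖α - 2‖ / ((e + e).1 * (e + e).2.2 - normSq (e + e).2.1) := by
  have h2e := (posDef_hermTwo_iff (e + e)).mp (by rw [hermTwo_add]; exact he.add he)
  set δ : ℝ := (e + e).1 * (e + e).2.2 - normSq (e + e).2.1 with hδdef
  have hδ : 0 < δ := by rw [hδdef]; linarith [h2e.2]
  set p : ℝ := (c + e).1 * (c + e).2.2 - normSq (c + e).2.1 with hpdef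
  have hδp : δ ≤ p := det_two_le_det_add he hc
  have hp : 0 < p := lt_of_lt_of_le hδ hδp
  have hbt : 0 < c.2.2 - e.2.2 := sub_snd_pos_of_mem hc
  have he3 : 0 < e.2.2 := by
    have hee := (posDef_hermTwo_iff e).mp he
    exact snd_pos_of_cone hee.1 hee.2
  have hbe : 0 < c.2.2 + e.2.2 := by linarith
  rw [etaShiftWeight_hermTwo]
  have hp' : (((c.1 + e.1) * (c.2.2 + e.2.2) - normSq (c.2.1 + e.2.1) : ℝ) : ℂ) = (p : ℂ) := by
    simp only [hpdef, Prod.fst_add, Prod.snd_add]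
  rw [hp', norm_div, Complex.norm_of_nonneg hbt.le, div_eq_mul_inv]
  refine le_trans (mul_le_mul_of_nonneg_right (norm_sub_le _ _) (inv_nonneg.mpr hbt.le)) ?_
  rw [norm_mul, norm_div, Complex.norm_of_nonneg hbe.le, Complex.norm_of_nonneg hp.le]
  -- `(b + e₃)/p ≤ (b − e₃)/δ + 2e₃/δ`
  have hkey : (c.2.2 + e.2.2) / p ≤ (c.2.2 - e.2.2) / δ + 2 * e.2.2 / δ := by
    rw [← add_div, show c.2.2 - e.2.2 + 2 * e.2.2 = c.2.2 + e.2.2 by ring]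
    exact div_le_div_of_nonneg_left hbe.le hδ hδp
  have hα0 : 0 ≤ ‖α - 2‖ := norm_nonneg _
  have hg0 : 0 ≤ ‖g 0 0‖ := norm_nonneg _
  calc (‖g 0 0‖ + ‖α - 2‖ * ((c.2.2 + e.2.2) / p)) * (c.2.2 - e.2.2)⁻¹
      ≤ (‖g 0 0‖ + ‖α - 2‖ * ((c.2.2 - e.2.2) / δ + 2 * e.2.2 / δ)) * (c.2.2 - e.2.2)⁻¹ := by gcongr
    _ = (‖g 0 0‖ + 2 * e.2.2 * ‖α - 2‖ / δ) * (c.2.2 - e.2.2)⁻¹ + ‖α - 2‖ / δ := by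
        field_simp
        ring

/-! ## The β-shifted integrand converges (`re β > 0`) -/

/-- **ABSOLUTE CONVERGENCE OF THE β-SHIFTED `η`** (organ Φ6b-6, file (2)): for positive definite `g, h`, every `α ∈ ℂ` and `re β > 0`, the
shifted integrand `Q_α(x) · e^{−tr(gx)} det(x + h)^{α−2} det(x − h)^{β−1}` is integrable on `{x ± h > 0} = {x − h > 0}` — one unit to the LEFT
of the abscissa `re β > 1` of `η` itself. -/
theorem integrableOn_etaShiftIntegrand {g h : Matrix (Fin 2) (Fin 2) ℂ} (hg : g.PosDef) (hh : h.PosDef) (α : ℂ) {β : ℂ} (hβ : 0 < β.re) :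
    IntegrableOn (etaShiftIntegrand g h α β) (etaTwoSet h) := by
  have hβ1 : 1 < (β + 1).re := by simp only [add_re, one_re]; linarith
  obtain ⟨e, rfl⟩ : ∃ e : ℝ × ℂ × ℝ, hermTwo e = h := ⟨_, hermTwo_eq_of_isHermitian hh.1⟩
  have hI1 := (integrableOn_inv_mul_etaTwoIntegrand_of_posDef hg hh α hβ1).norm.const_mul
    (‖g 0 0‖ + 2 * e.2.2 * ‖α - 2‖ / ((e + e).1 * (e + e).2.2 - normSq (e + e).2.1))
  have hI2 := (integrableOn_etaTwoIntegrand_of_posDef hg hh α hβ1).norm.const_mul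
    (‖α - 2‖ / ((e + e).1 * (e + e).2.2 - normSq (e + e).2.1))
  refine (hI1.add hI2).mono' (aestronglyMeasurable_etaShiftIntegrand g (hermTwo e) α β _) ?_
  refine (ae_restrict_iff' (measurableSet_etaTwoSet hh.1)).mpr (Filter.Eventually.of_forall fun c hc => ?_)
  obtain ⟨-, hcm⟩ := (mem_etaTwoSet_iff (hermTwo e) c).mp hc
  have hbt : 0 < c.2.2 - e.2.2 := sub_snd_pos_of_mem hcm
  have hW := norm_etaShiftWeight_le g hh hcm α
  rw [etaShiftIntegrand_apply, norm_mul]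
  simp only [Pi.add_apply]
  rw [norm_mul, norm_inv, hermTwo_sub_apply_one_one, hermTwo_apply_one_one, ← Complex.ofReal_sub, Complex.norm_of_nonneg hbt.le]
  calc ‖etaShiftWeight g (hermTwo e) α c‖ * ‖etaTwoIntegrand g (hermTwo e) α (β + 1) c‖
      ≤ ((‖g 0 0‖ + 2 * e.2.2 * ‖α - 2‖ / ((e + e).1 * (e + e).2.2 - normSq (e + e).2.1)) * (c.2.2 - e.2.2)⁻¹ +
          ‖α - 2‖ / ((e + e).1 * (e + e).2.2 - normSq (e + e).2.1)) * ‖etaTwoIntegrand g (hermTwo e) α (β + 1) c‖ :=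
        mul_le_mul_of_nonneg_right hW (norm_nonneg _)
    _ = (‖g 0 0‖ + 2 * e.2.2 * ‖α - 2‖ / ((e + e).1 * (e + e).2.2 - normSq (e + e).2.1)) *
          ((c.2.2 - e.2.2)⁻¹ * ‖etaTwoIntegrand g (hermTwo e) α (β + 1) c‖) +
        ‖α - 2‖ / ((e + e).1 * (e + e).2.2 - normSq (e + e).2.1) * ‖etaTwoIntegrand g (hermTwo e) α (β + 1) c‖ := by
        ring

/-- `etaShift g h α β` for `h > 0` is the integral of the shifted integrand over `{x − h > 0}`. -/
theorem etaShift_eq_integral_of_posDef {g h : Matrix (Fin 2) (Fin 2) ℂ} (hh : h.PosDef) (α β : ℂ) :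
    etaShift g h α β = ∫ c in {c : ℝ × ℂ × ℝ | (hermTwo c - h).PosDef}, etaShiftIntegrand g h α β c := by
  rw [etaShift_def, etaTwoSet_eq_of_posSemidef hh.posSemidef]

end Summit.HodgeConjecture.HodgeConjecture.Cruxes.HLiu418.K2LiuHermTwoEtaShiftConvergence

end
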